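import Literature.MathematicalPhysics.QuantumLattice.AnisotropicXYLongRangeOrder
import Literature.MathematicalPhysics.QuantumFieldTheory.Balaban1983to89.Beta.PuncturedRiemannSum
import HarnessLib

/-!
# The anisotropic Kennedy–Lieb–Shastry lattice integral `I_K` and long-range order for
# direction-dependent couplings conditional on the single inequality `I_K < S√2` (`d ≥ 3`)

Topic `MathematicalPhysics/QuantumLattice`; completes `AnisotropicXYLongRangeOrder.lean` by
"passing from sums to integrals" ([KLS1988PRL], before eq. (2); [DLS1978] §3): the punctured
Riemann sums `R^K_L` (`anisoKlsRiemannSum`) of the anisotropic KLS integrand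
`F_K(p) = {Σᵢ Kᵢ cos pᵢ}₊ [2/(κ_K E^K_p)]^{1/2}` converge along the even sides to
`I_K = (2π)^{-d}∫_{[-π,π]^d} F_K` (`anisoKlsIntegral`), for `K > 0` and `d ≥ 3`, by the tree's
punctured-Riemann-sum theorem for symbols with an integrable `1/E` singularity
(`PuncturedRiemannSum.momentumAverage_singular_approx`; here `F_K ≤ ½ + (κ_K/min K)/E_p`).
Consequently the ground-state and low-temperature long-range order of
`H_K = -Σ_xΣᵢ Kᵢ(S¹_xS¹_{x+eᵢ} + S²_xS²_{x+eᵢ})` on the even tori `(ℤ/2kℤ)^d`, `d ≥ 3`, spin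
`S = n/2`, holds under the single numerical hypothesis `I_K < n√2/2`
(`xyAniso_longRangeOrder_ground_of_integral`, `xyAniso_longRangeOrder_thermal_of_integral`) — for
`K = (1, 1, r)` the layered model of [KLS1988JSP] §3 (eq. (5)) in its XY / hard-core-boson version,
ground state and the positive-temperature transition announced on p. 1020. One definition
(`anisoKlsIntegral`); no named fact. (In `d = 2` the same limit holds by dominated convergence with
the `‖p‖⁻¹` majorant, as in `XYOrderRiemannSumProofs.lean`; not needed for the layered model and
not done here.)

## References

* [KLS1988PRL] T. Kennedy, E. H. Lieb, B. S. Shastry, Phys. Rev. Lett. 61 (1988) 2582–2584,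
  before eq. (2) ("taking the usual infinite-volume limit and passing from sums to integrals"),
  eqs. (7)–(8).
* [KLS1988JSP] T. Kennedy, E. H. Lieb, B. S. Shastry, J. Stat. Phys. 53 (1988) 1019–1030, §3,
  eqs. (5)–(9), p. 1020.
* [DLS1978] F. J. Dyson, E. H. Lieb, B. Simon, J. Stat. Phys. 18 (1978) 335–383, §3, Thm. 5.1.
-/

noncomputable section

open MeasureTheory Filter Topology Finset
open Literature.MathematicalPhysics.QuantumLattice Literature.Probability.LatticeModels
  Literature.MathematicalPhysics.QuantumLattice.XYOrderProofs
  Literature.Barriers.AtomisticToContinuum.BoseGas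
  Literature.MathematicalPhysics.QuantumFieldTheory.Balaban1983to89.Beta

namespace Literature.MathematicalPhysics.QuantumLattice

variable {d : ℕ}

/-- **The anisotropic KLS lattice integral** `I_K = (2π)^{-d}∫_{[-π,π]^d} F_K(p) dp`,
`F_K(p) = {Σᵢ Kᵢ cos pᵢ}₊ [2/(κ_K E^K_p)]^{1/2}` (Lebesgue integral over the Brillouin zone).
[cite: KLS1988PRL, eq. (8)] [cite: KLS1988JSP, eq. (9)] -/
def anisoKlsIntegral (K : Fin d → ℝ) : ℝ :=
  (∫ p in brillouin d, anisoKlsIntegrand K p) / (2 * Real.pi) ^ d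

/-! ### The integrand: periodicity, continuity off the origin, the `1/E` majorant -/

section Integrand

variable {K : Fin d → ℝ}

/-- `F_K` is `2π`-periodic in every coordinate (it depends on `p` only through the `cos pᵢ`).
[cite: KLS1988PRL, eq. (8)] -/
theorem anisoKlsIntegrand_add_two_pi_mul_int (K : Fin d → ℝ) (p : Fin d → ℝ) (q : Fin d → ℤ) :
    anisoKlsIntegrand K (fun i => p i + 2 * Real.pi * (q i : ℝ)) = anisoKlsIntegrand K p := by
  have hc : ∀ i, Real.cos (p i + 2 * Real.pi * (q i : ℝ)) = Real.cos (p i) := fun i => by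
    rw [show p i + 2 * Real.pi * (q i : ℝ) = p i + (q i : ℝ) * (2 * Real.pi) by ring,
      Real.cos_add_int_mul_two_pi]
  simp only [anisoKlsIntegrand, anisoCosSum, NVectorAniso.anisoDispersion, hc]

/-- `E^K_p ≥ m E_p` when `m ≤ Kᵢ` for all `i`. [cite: KLS1988JSP, eq. (7)] -/
theorem mul_dispersion_le_anisoDispersion {m : ℝ} (hmK : ∀ i, m ≤ K i) (p : Fin d → ℝ) :
    m * dispersion p ≤ NVectorAniso.anisoDispersion K p := by
  rw [dispersion, NVectorAniso.anisoDispersion, mul_sum]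
  exact sum_le_sum fun i _ => mul_le_mul_of_nonneg_right (hmK i) (sub_nonneg.2 (Real.cos_le_one _))

/-- `F_K` is continuous at every `p` with `E^K_p > 0` (`K > 0`, `d ≥ 1`).
[cite: KLS1988PRL, eq. (8)] -/
theorem continuousAt_anisoKlsIntegrand (hd : 1 ≤ d) (hK : ∀ i, 0 < K i) {p : Fin d → ℝ}
    (hp : 0 < NVectorAniso.anisoDispersion K p) : ContinuousAt (anisoKlsIntegrand K) p := by
  have hκ : 0 < ∑ i, K i := by
    obtain ⟨i⟩ : Nonempty (Fin d) := ⟨⟨0, hd⟩⟩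
    exact lt_of_lt_of_le (hK i) (single_le_sum (fun j _ => (hK j).le) (mem_univ i))
  have hC : Continuous fun q : Fin d → ℝ => anisoCosSum K q := by
    unfold anisoCosSum; fun_prop
  have hE : Continuous fun q : Fin d → ℝ => NVectorAniso.anisoDispersion K q := by
    unfold NVectorAniso.anisoDispersion; fun_prop
  have h1 : ContinuousAt (fun q : Fin d → ℝ =>
      2 / ((∑ i, K i) * NVectorAniso.anisoDispersion K q)) p :=
    continuousAt_const.div (continuousAt_const.mul hE.continuousAt) (mul_ne_zero hκ.ne' hp.ne')
  exact ((hC.max continuous_const).continuousAt).mul h1.sqrt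

/-- **The `1/E` majorant**: on the Brillouin zone, for `0 < m ≤ Kᵢ` and `p ≠ 0`,
`F_K(p) ≤ ½ + (κ_K/m)/E_p` (`{C_K}₊ ≤ κ_K`, `E^K ≥ mE`, and `√y ≤ (1 + y)/2`).
[cite: KLS1988PRL, eq. (8)] [cite: DysonLiebSimon1978, §3] -/
theorem anisoKlsIntegrand_le_inv_dispersion (hd : 1 ≤ d) {m : ℝ} (hm : 0 < m)
    (hmK : ∀ i, m ≤ K i) {p : Fin d → ℝ} (hp : p ∈ brillouin d) (hp0 : p ≠ 0) :
    anisoKlsIntegrand K p ≤ 1 / 2 + (∑ i, K i) / m / dispersion p := by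
  have hK : ∀ i, 0 < K i := fun i => hm.trans_le (hmK i)
  set κ : ℝ := ∑ i, K i with hκ_def
  have hκ : 0 < κ := by
    obtain ⟨i⟩ : Nonempty (Fin d) := ⟨⟨0, hd⟩⟩
    exact lt_of_lt_of_le (hK i) (single_le_sum (fun j _ => (hK j).le) (mem_univ i))
  have hE : 0 < dispersion p := dispersion_pos_of_mem_brillouin hp hp0
  have hmE : m * dispersion p ≤ NVectorAniso.anisoDispersion K p :=
    mul_dispersion_le_anisoDispersion hmK p
  have hEK : 0 < NVectorAniso.anisoDispersion K p := lt_of_lt_of_le (by positivity) hmE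
  set y : ℝ := 2 * κ / (m * dispersion p) with hy_def
  have hy : 0 ≤ y := by positivity
  calc anisoKlsIntegrand K p
      ≤ κ * Real.sqrt (2 / (κ * (m * dispersion p))) :=
        mul_le_mul (max_le (anisoCosSum_le (fun i => (hK i).le) p) hκ.le)
          (Real.sqrt_le_sqrt (div_le_div_of_nonneg_left (by norm_num) (by positivity)
            (mul_le_mul_of_nonneg_left hmE hκ.le)))
          (Real.sqrt_nonneg _) hκ.le
    _ = Real.sqrt y := by
        rw [← Real.sqrt_sq hκ.le, ← Real.sqrt_mul (sq_nonneg κ), Real.sqrt_sq hκ.le]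
        congr 1
        rw [hy_def]
        field_simp
    _ ≤ (1 + y) / 2 := by
        nlinarith [Real.sq_sqrt hy, Real.sqrt_nonneg y, sq_nonneg (Real.sqrt y - 1)]
    _ = 1 / 2 + κ / m / dispersion p := by
        rw [hy_def]
        field_simp

end Integrand

/-! ### Sums to integrals along the even sides (`d ≥ 3`) -/

section SumsToIntegrals

/-- **"Passing from sums to integrals"** ([KLS1988PRL] before eq. (2); [DLS1978] §3) for the
anisotropic KLS integrand, `d ≥ 3`, `K > 0`: for every `ε > 0` there is `L₀` with
`|R^K_L - I_K| ≤ ε` for all even `L ≥ L₀` (the tree's punctured-Riemann-sum theorem for symbols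
with an integrable `1/E` singularity, `PuncturedRiemannSum.momentumAverage_singular_approx`).
[cite: KLS1988PRL, before eq. (2)] [cite: DysonLiebSimon1978, §3] -/
theorem anisoKlsRiemannSum_approx (hd3 : 3 ≤ d) {K : Fin d → ℝ} (hK : ∀ i, 0 < K i) {ε : ℝ}
    (hε : 0 < ε) :
    ∃ L₀ : ℕ, ∀ (L : ℕ) [NeZero L], Even L → L₀ ≤ L →
      |anisoKlsRiemannSum K L - anisoKlsIntegral K| ≤ ε := by
  have hd : 1 ≤ d := by omega
  obtain ⟨i₀, -, hi₀⟩ := exists_min_image univ K ⟨⟨0, by omega⟩, mem_univ _⟩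
  have hm : 0 < K i₀ := hK i₀
  have hmK : ∀ i, K i₀ ≤ K i := fun i => hi₀ i (mem_univ i)
  have hκ0 : 0 ≤ ∑ i, K i := sum_nonneg fun i _ => (hK i).le
  have hG : ContinuousOn (anisoKlsIntegrand K) (brillouin d \ {0}) := by
    intro p hp
    have hp0 : p ≠ 0 := fun h => hp.2 h
    have hE : 0 < dispersion p := dispersion_pos_of_mem_brillouin hp.1 hp0
    have hEK : 0 < NVectorAniso.anisoDispersion K p :=
      lt_of_lt_of_le (by positivity) (mul_dispersion_le_anisoDispersion hmK p)
    exact (continuousAt_anisoKlsIntegrand hd hK hEK).continuousWithinAt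
  have hB : ∀ p ∈ brillouin d, p ≠ 0 →
      ‖anisoKlsIntegrand K p‖ ≤ 1 / 2 + (∑ i, K i) / K i₀ / dispersion p := by
    intro p hp hp0
    rw [Real.norm_of_nonneg (anisoKlsIntegrand_nonneg K p)]
    exact anisoKlsIntegrand_le_inv_dispersion hd hm hmK hp hp0
  obtain ⟨L₀, hL₀⟩ := PuncturedRiemannSum.momentumAverage_singular_approx hd3
    (G := anisoKlsIntegrand K) (by norm_num : (0 : ℝ) ≤ 1 / 2) (by positivity) hG hB
    (anisoKlsIntegrand_add_two_pi_mul_int K) hε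
  refine ⟨L₀, fun L _ hev hL => ?_⟩
  have h := hL₀ L hev hL
  have hLd : ((L ^ d : ℕ) : ℝ) = (L : ℝ) ^ d := by push_cast; ring
  rw [smul_eq_mul, smul_eq_mul, hLd, inv_mul_eq_div, inv_mul_eq_div,
    ← anisoKlsRiemannSum_of_neZero, Real.norm_eq_abs] at h
  exact h

/-- Consequently: if `I_K < t` then eventually along the even sides `R^K_{2k} ≤ (I_K + t)/2 < t`.
[cite: KLS1988PRL, before eq. (2)] -/
theorem anisoKlsRiemannSum_eventually_le (hd3 : 3 ≤ d) {K : Fin d → ℝ} (hK : ∀ i, 0 < K i)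
    {t : ℝ} (hI : anisoKlsIntegral K < t) :
    ∀ᶠ k : ℕ in atTop, anisoKlsRiemannSum K (2 * k) ≤ (anisoKlsIntegral K + t) / 2 := by
  obtain ⟨L₀, hL₀⟩ := anisoKlsRiemannSum_approx hd3 hK (ε := (t - anisoKlsIntegral K) / 2)
    (by linarith)
  filter_upwards [eventually_ge_atTop (L₀ + 1)] with k hk
  haveI : NeZero (2 * k) := ⟨by omega⟩
  have h := hL₀ (2 * k) (even_two_mul k) (by omega)
  rw [abs_le] at h
  linarith [h.2]

end SumsToIntegrals

/-! ### Long-range order conditional on `I_K < S√2` -/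

section Order

/-- **Ground-state long-range order, hypotheses along the even sides** (the same as
`xyAniso_longRangeOrder_ground` with the eventual bound on `R^K` required only along `L = 2k`).
[cite: KLS1988PRL, Theorem, eqs. (7)–(8)] [cite: KLS1988JSP, §3] -/
theorem xyAniso_longRangeOrder_ground_even (hd : 1 ≤ d) {K : Fin d → ℝ} (hK : ∀ i, 0 < K i)
    {n : ℕ} (hn : 1 ≤ n) {ρ : ℝ} (hρ : ρ < n * Real.sqrt 2 / 2)
    (hR : ∀ᶠ k : ℕ in atTop, anisoKlsRiemannSum K (2 * k) ≤ ρ) :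
    HasEvenTorusLRO (fun L x y => xyAnisoGroundCorr 0 L n K x y + xyAnisoGroundCorr 1 L n K x y) ∧
      2 * (((n : ℝ) / 2) ^ 2 / 2 - 1 / 2 * Real.sqrt (((n : ℝ) / 2) ^ 2 / 2) * max ρ 0) ≤
        liminf (fun k : ℕ => (∑ x ∈ halfOpenBox d (2 * k), ∑ y ∈ halfOpenBox d (2 * k),
          torusPullback (fun L x y => xyAnisoGroundCorr 0 L n K x y + xyAnisoGroundCorr 1 L n K x y)
            (2 * k) x y) / ((halfOpenBox d (2 * k)).card : ℝ) ^ 2) atTop := by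
  set s : ℝ := ((n : ℝ) / 2) ^ 2 / 2 with hs_def
  have hn1 : (1 : ℝ) ≤ n := by exact_mod_cast hn
  have hs : 0 < s := by positivity
  have hκ : 0 < ∑ i, K i := by
    obtain ⟨i⟩ : Nonempty (Fin d) := ⟨⟨0, hd⟩⟩
    exact lt_of_lt_of_le (hK i) (single_le_sum (fun j _ => (hK j).le) (mem_univ i))
  have hsq : Real.sqrt s = n * Real.sqrt 2 / 4 := by
    have h2 : s = (n * Real.sqrt 2 / 4) ^ 2 := by
      rw [hs_def, div_pow, div_pow, mul_pow, Real.sq_sqrt (by norm_num : (0 : ℝ) ≤ 2)]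
      ring
    rw [h2, Real.sqrt_sq (by positivity)]
  have hρ' : ρ < 2 * Real.sqrt s := by rw [hsq]; linarith
  have hev : ∀ᶠ k : ℕ in atTop, ∃ e g : ℝ,
      (∑ x ∈ halfOpenBox d (2 * k), ∑ y ∈ halfOpenBox d (2 * k),
          torusPullback (fun L x y => xyAnisoGroundCorr 0 L n K x y + xyAnisoGroundCorr 1 L n K x y)
            (2 * k) x y) / ((halfOpenBox d (2 * k)).card : ℝ) ^ 2 = 2 * g ∧
        e ≤ g + 1 / 2 * Real.sqrt e * anisoKlsRiemannSum K (2 * k) ∧ s ≤ e := by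
    filter_upwards [eventually_ge_atTop 2] with k hk2
    haveI : NeZero (2 * k) := ⟨by omega⟩
    refine ⟨(∑ i, K i * xyAnisoDirBondCorr 0 (2 * k) n K i) / ∑ i, K i,
      xyAnisoStructureFactor 0 (2 * k) n K 0 / ((2 * k : ℕ) : ℝ) ^ d,
      xyAniso_lroSeq_eq n K k (by omega),
      xyAniso_kls_ineq7_ground hd (2 * k) n hK ⟨k, by ring⟩ (by omega), ?_⟩
    rw [hs_def, le_div_iff₀ hκ]
    exact xyAniso_weightedBondCorr_lower (2 * k) n K (by omega)
  obtain ⟨hlim, hc⟩ := anisoKls_margin_ground hs hρ' hR _ (xyAniso_lroSeq_le n K) hev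
  exact ⟨(hasEvenTorusLRO_iff _).2 (hc.trans_le hlim), hlim⟩

/-- **Ground-state long-range order for direction-dependent couplings, conditional on the single
inequality `I_K < S√2`** (`d ≥ 3`, `K > 0`, `S = n/2 ≥ ½`): Kennedy–Lieb–Shastry's theorem for
`H_K` ([KLS1988PRL] Theorem with eq. (8) replaced by the anisotropic integral; [KLS1988JSP] §3 for
`K = (1,1,r)`), XY / hard-core-boson version. [cite: KLS1988PRL, Theorem, eq. (8)]
[cite: KLS1988JSP, §3] -/
theorem xyAniso_longRangeOrder_ground_of_integral (hd3 : 3 ≤ d) {K : Fin d → ℝ}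
    (hK : ∀ i, 0 < K i) {n : ℕ} (hn : 1 ≤ n)
    (hI : anisoKlsIntegral K < n * Real.sqrt 2 / 2) :
    HasEvenTorusLRO
      (fun L x y => xyAnisoGroundCorr 0 L n K x y + xyAnisoGroundCorr 1 L n K x y) :=
  (xyAniso_longRangeOrder_ground_even (by omega) hK hn
    (ρ := (anisoKlsIntegral K + n * Real.sqrt 2 / 2) / 2) (by linarith)
    (anisoKlsRiemannSum_eventually_le hd3 hK hI)).1

/-- **Long-range order at low temperature for direction-dependent couplings, conditional on the
single inequality `I_K < S√2`** (`d ≥ 3`, `K > 0`, `S = n/2 ≥ ½`): there is `β₀ > 0` such that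
for every `β ≥ β₀` the Gibbs states of `H_K` on the even tori `(ℤ/2kℤ)^d` have long-range order
(the thermal term by `J^K_L ≤ T_L/min K` and the lattice Green function, `d ≥ 3`). For
`K = (1, 1, r)`, `r > 0`: the positive-temperature transition of the layered hard-core-boson /
quantum XY model announced in [KLS1988JSP] p. 1020, modulo `I_K < 1/√2`.
[cite: DysonLiebSimon1978, Thms. 5.1, 5.2] [cite: KLS1988JSP, p. 1020]
[cite: KLS1988PRL, Theorem, eq. (8)] -/
theorem xyAniso_longRangeOrder_thermal_of_integral (hd3 : 3 ≤ d) {K : Fin d → ℝ}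
    (hK : ∀ i, 0 < K i) {n : ℕ} (hn : 1 ≤ n)
    (hI : anisoKlsIntegral K < n * Real.sqrt 2 / 2) :
    ∃ β₀ : ℝ, 0 < β₀ ∧ ∀ β : ℝ, β₀ ≤ β →
      HasEvenTorusLRO (fun L x y => xyAnisoThermalCorr β K L n x y) := by
  have hd : 1 ≤ d := by omega
  obtain ⟨i₀, -, hi₀⟩ := exists_min_image univ K ⟨⟨0, by omega⟩, mem_univ _⟩
  have hm : 0 < K i₀ := hK i₀
  have hmK : ∀ i, K i₀ ≤ K i := fun i => hi₀ i (mem_univ i)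
  obtain ⟨𝒯, k₀, h𝒯0, h𝒯⟩ := torusGreen_zero_eventually_le (d := d) hd3
  have hJ : ∀ᶠ k : ℕ in atTop, anisoKlsThermalSum K (2 * k) ≤ 𝒯 / K i₀ := by
    filter_upwards [eventually_ge_atTop k₀, eventually_ge_atTop 1] with k hk hk1
    haveI : NeZero (2 * k) := ⟨by omega⟩
    exact (anisoKlsThermalSum_le_torusGreen_div hd (2 * k) hm hmK).trans
      (div_le_div_of_nonneg_right (h𝒯 k hk hk1) hm.le)
  exact xyAniso_longRangeOrder_thermal_even hd hK hn
    (ρ := (anisoKlsIntegral K + n * Real.sqrt 2 / 2) / 2) (by linarith) (div_nonneg h𝒯0 hm.le)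
    (anisoKlsRiemannSum_eventually_le hd3 hK hI) hJ

end Order

end Literature.MathematicalPhysics.QuantumLattice
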